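import Literature.NumberTheory.Automorphic.ArtinLFunctionsRankOneMatching
import Mathlib.FieldTheory.Galois.Infinite
import HarnessLib

/-!
# The completed Artin factorisation of `ζ_M` for the field `M` cut out by a character of degree one, with `M` explicit

Topic `Literature/NumberTheory/Automorphic`; namespace `Literature.NumberTheory.Automorphic`.  Pure-proof
companion of `ArtinLFunctionsRankOneMatching.lean`.

> **Neukirch VII (12.3)/(10.4).** For the field `M = K̄^{ker ψ}` cut out by a character `ψ : Γ_K → GL_1(ℂ)` with
> image of order `n`, `Λ_{ζ_M}(s) = ∏_{j<n} Λ(s, ψ^j)` and `ζ_M(s) = ∏_{j<n} L(s, ψ^j)` (`re s > 1`): the regular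
> representation of the cyclic group `ψ(Γ_K)` is `⊕_j ψ^j`, it is induced from the trivial character of
> `Γ_M` ((10.4) (iv)), and `𝔣(Ind 𝟙) = 𝔡_{M|K}` ((11.7) (iii)).

The tree's `exists_completedDedekindZeta_eq_prod` proves exactly this but HIDES the field `M` behind an
existential (`∃ (M : Type u) …`), which makes it impossible to identify `M` with a given finite cyclic extension.
This file re-runs the same proof with `M` EXPLICIT: for any intermediate field `M₀ ⊆ K̄` whose fixing group is
`ker ψ` (`M₀.fixingSubgroup = ker (det ψ)`),

* `completedDedekindZeta_eq_prod_of_fixingSubgroup_eq` — `Λ_{ζ_{M₀}}(s) = ∏_{j<n} Λ(s, ψ^j)`,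
  `ζ_{M₀}(s) = ∏_{j<n} L(s, ψ^j)` for `re s > 1`, `[M₀ : K] = n = |ψ(Γ_K)|`, `(det ψ)^n = 1`, and some
  `det ψ(γ₀)` has order `n`;

with no non-triviality hypothesis (`n = 1` allowed).  Used by `ArtinLFunctionsCyclicHeckeFactorisation.lean`
(Hecke factorisation of `ζ_L` for a cyclic `L ⊆ K̄` and the conductor–discriminant formula).

## References

* J. Neukirch, *Algebraic Number Theory*, Springer 1999, Ch. VII (12.3) (i), (iii); (11.7) (iii); (10.4);
  p. 522. [NeukirchANT1999]
-/

noncomputable section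

open scoped NumberField
open Field IsDedekindDomain NumberField NumberField.InfinitePlace Complex Filter Topology
open Literature.NumberTheory.GaloisRepresentations Literature.NumberTheory.LFunctions
open Literature.RepresentationTheory.FiniteGroups

universe u

namespace Literature.NumberTheory.Automorphic

variable {K : Type u} [Field K] [NumberField K]

/-! ### Transport along an equality of intermediate fields -/

omit [NumberField K] in
/-- Equal intermediate fields have the same degree. [folklore] -/
private theorem finrank_congr_of_eq {F : Type*} [Field F] [Algebra K F] {X Y : IntermediateField K F} (h : X = Y) :
    Module.finrank K X = Module.finrank K Y := by subst h; rfl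

omit [NumberField K] in
/-- Equal intermediate fields have the same Dedekind zeta function. [folklore] -/
private theorem dedekindZeta_congr_of_eq {F : Type*} [Field F] [Algebra K F] {X Y : IntermediateField K F} (h : X = Y)
    [hX : NumberField X] [hY : NumberField Y] :
    NumberField.dedekindZeta X = NumberField.dedekindZeta Y := by subst h; rfl

omit [NumberField K] in
/-- Equal intermediate fields have the same completed Dedekind zeta function. [folklore] -/
private theorem completedDedekindZeta_congr_of_eq {F : Type*} [Field F] [Algebra K F] {X Y : IntermediateField K F}
    (h : X = Y) [hX : NumberField X] [hY : NumberField Y] :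
    completedDedekindZeta X = completedDedekindZeta Y := by subst h; rfl

/-! ### The explicit factorisation -/

/-- **The completed Artin factorisation of `ζ_M` with `M` explicit** (Neukirch VII (12.3) (i), (iii) with
(11.7) (iii) for the regular representation, (10.4)).  Let `ψ : Γ_K → GL_1(ℂ)` and let `M₀ ⊆ K̄` be an
intermediate field, finite over `K`, with `Gal(K̄/M₀) = ker ψ`.  Then with `n = |ψ(Γ_K)|` and the powers
`ψ^j` (`det ψ^j = (det ψ)^j`): `[M₀ : K] = n`, `(det ψ)^n = 1`, some `det ψ(γ₀)` has order `n`, and for `re s > 1`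
`Λ_{ζ_{M₀}}(s) = ∏_{j<n} Λ(s, ψ^j)` and `ζ_{M₀}(s) = ∏_{j<n} L(s, ψ^j)`.
[cite: NeukirchANT1999, Ch. VII (12.3) (i), (iii); (11.7) (iii); (10.4) (i), (ii), (iv); p. 522] -/
theorem completedDedekindZeta_eq_prod_of_fixingSubgroup_eq (ψ : FramedArtinRep K 1)
    (M₀ : IntermediateField K (AlgebraicClosure K)) [NumberField M₀]
    (hM₀ : M₀.fixingSubgroup = (FramedRep.det ψ).toMonoidHom.ker) :
    ∃ (Ψ : ℕ → FramedArtinRep K 1) (n : ℕ), Ψ 1 = ψ ∧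
      (∀ (j : ℕ) (γ : absoluteGaloisGroup K), FramedRep.det (Ψ j) γ = FramedRep.det ψ γ ^ j) ∧
      0 < n ∧ Module.finrank K M₀ = n ∧
      (∀ γ : absoluteGaloisGroup K, FramedRep.det ψ γ ^ n = 1) ∧
      (∃ γ₀ : absoluteGaloisGroup K, orderOf (FramedRep.det ψ γ₀) = n) ∧
      ∀ s : ℂ, 1 < s.re →
        completedDedekindZeta M₀ s = ∏ j ∈ Finset.range n, completedArtinLFunction (Ψ j).toArtinRep s ∧
        NumberField.dedekindZeta M₀ s = ∏ j ∈ Finset.range n, artinLFunction (Ψ j).toArtinRep s := by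
  classical
  -- the powers `ψ^j : Γ_K → GL_1(ℂ)`
  let D : ℕ → (absoluteGaloisGroup K →* ℂˣ) := fun j ↦
    { toFun := fun γ ↦ FramedRep.det ψ γ ^ j
      map_one' := by rw [map_one, one_pow]
      map_mul' := fun a b ↦ by rw [map_mul, mul_pow] }
  have hDc : ∀ j, Continuous (D j) := fun j ↦ (continuous_pow j).comp (FramedRep.det ψ).continuous_toFun
  let Ψ : ℕ → FramedArtinRep K 1 := fun j ↦
    ContinuousMonoidHom.comp (FramedRep.unitsContinuousMulEquivOfUnique (Fin 1) ℂ : ℂˣ →ₜ* GL (Fin 1) ℂ) ⟨D j, hDc j⟩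
  have hΨcoe : ∀ (j : ℕ) (γ : absoluteGaloisGroup K) (i k : Fin 1),
      ((Ψ j γ : GL (Fin 1) ℂ) : Matrix (Fin 1) (Fin 1) ℂ) i k = ((FramedRep.det ψ γ ^ j : ℂˣ) : ℂ) := fun _ _ _ _ ↦ rfl
  have hdetΨ : ∀ (j : ℕ) (γ : absoluteGaloisGroup K), FramedRep.det (Ψ j) γ = FramedRep.det ψ γ ^ j := fun j γ ↦
    Units.ext (by rw [FramedRep.det_apply, Matrix.GeneralLinearGroup.val_det_apply, Matrix.det_fin_one, hΨcoe])
  have hΨ1 : Ψ 1 = ψ := ContinuousMonoidHom.ext fun γ ↦ generalLinearGroup_fin_one_eq_of_det_eq (by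
    rw [← FramedRep.det_apply, ← FramedRep.det_apply, hdetΨ, pow_one])
  have hcharΨ : ∀ (j : ℕ) (γ : absoluteGaloisGroup K),
      (Ψ j).toArtinRep.toRepresentation.character γ = ((FramedRep.det ψ γ : ℂˣ) : ℂ) ^ j := fun j γ ↦ by
    rw [character_toArtinRep_rankOne, hdetΨ, Units.val_pow_eq_pow_val]
  -- the scalar character, its finite image `G`, `q : Γ_K ↠ G`
  set d : absoluteGaloisGroup K →* ℂˣ := (FramedRep.det ψ).toMonoidHom with hd
  have hdapp : ∀ γ, d γ = FramedRep.det ψ γ := fun γ ↦ rfl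
  have hker : d.ker = ψ.toMonoidHom.ker := by
    ext γ
    rw [MonoidHom.mem_ker, MonoidHom.mem_ker, hdapp, det_eq_one_iff_rankOne]
    rfl
  have hopen : IsOpen (d.ker : Set (absoluteGaloisGroup K)) := by rw [hker]; exact ψ.isOpen_ker_toMonoidHom
  haveI : Finite (absoluteGaloisGroup K ⧸ d.ker) := Subgroup.quotient_finite_of_isOpen _ hopen
  haveI : Finite d.range := Finite.of_equiv _ (QuotientGroup.quotientKerEquivRange d).toEquiv
  letI : Fintype d.range := Fintype.ofFinite _
  set q : absoluteGaloisGroup K →* d.range := d.rangeRestrict with hq_def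
  have hq : IsArtinQuotient q := ⟨MonoidHom.rangeRestrict_surjective d, by rw [hq_def, MonoidHom.ker_rangeRestrict]; exact hopen⟩
  have hqval : ∀ γ, ((q γ : d.range) : ℂˣ) = FramedRep.det ψ γ := fun γ ↦ rfl
  set n : ℕ := Fintype.card d.range with hn
  have h0n : 0 < n := Fintype.card_pos
  have hpow : ∀ γ : absoluteGaloisGroup K, FramedRep.det ψ γ ^ n = 1 := fun γ ↦ by
    have h0 := pow_card_eq_one (G := d.range) (x := q γ)
    have := congrArg (fun x : d.range ↦ (x : ℂˣ)) h0
    simpa only [SubmonoidClass.coe_pow, hqval, OneMemClass.coe_one] using this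
  have hgen : ∃ γ₀ : absoluteGaloisGroup K, orderOf (FramedRep.det ψ γ₀) = n := by
    haveI : IsCyclic d.range := inferInstance
    obtain ⟨g, hg⟩ := IsCyclic.exists_ofOrder_eq_natCard (α := d.range)
    obtain ⟨γ₀, hγ₀⟩ := MonoidHom.rangeRestrict_surjective d g
    refine ⟨γ₀, ?_⟩
    rw [← hqval, hq_def, hγ₀, Subgroup.orderOf_coe, hg, hn, Nat.card_eq_fintype_card]
  -- the field `M = K̄^{ker ψ}` of the tree, and its identification with `M₀`
  set M := quotientFixedField q (⊥ : Subgroup d.range) with hM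
  haveI : FiniteDimensional K M := finiteDimensional_quotientFixedField hq ⊥
  haveI : NumberField M := NumberField.of_module_finite K M
  have hMM₀ : quotientFixedField q (⊥ : Subgroup d.range) = M₀ := by
    have h1 : (⊥ : Subgroup d.range).comap q = d.ker := by
      rw [MonoidHom.comap_bot, hq_def, MonoidHom.ker_rangeRestrict]
    exact (congrArg IntermediateField.fixedField (h1.trans hM₀.symm)).trans
      (InfiniteGalois.fixedField_fixingSubgroup M₀)
  have hdeg : Module.finrank K M₀ = n := by
    rw [← finrank_congr_of_eq hMM₀, finrank_quotientFixedField hq ⊥, Subgroup.index_bot, hn, Nat.card_eq_fintype_card]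
  refine ⟨Ψ, n, hΨ1, hdetΨ, h0n, hdeg, hpow, hgen, fun s hs ↦ ?_⟩
  rw [← completedDedekindZeta_congr_of_eq hMM₀, ← dedekindZeta_congr_of_eq hMM₀]
  change completedDedekindZeta M s = _ ∧ NumberField.dedekindZeta M s = _
  -- the regular representation of `G`, induced from the trivial character of `Γ_M`
  set σ := ArtinRep.monomial hq (⊥ : Subgroup d.range) 1 with hσ
  have hind := ArtinRep.isInducedFrom_monomial hq (⊥ : Subgroup d.range) 1
  have hcut1 : ∀ δ : absoluteGaloisGroup M, hq.cutCharacter ⊥ 1 δ = 1 := fun δ ↦ by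
    refine generalLinearGroup_fin_one_eq_of_det_eq (Units.ext ?_)
    rw [Matrix.GeneralLinearGroup.val_det_apply, Matrix.det_fin_one, IsArtinQuotient.cutCharacter_apply_coe,
      IsArtinQuotient.cutHom_apply, MonoidHom.one_apply, map_one]
  -- L-level: `L(σ) = L(𝟙_M) = ζ_M`
  have h4 : artinLFunction σ s = artinLFunction (hq.cutCharacter ⊥ 1).toArtinRep s :=
    artinLFunction_eq_of_isInducedFrom_holds (K := K) (M := M) σ _ hind s hs
  have hchar1 : ∀ δ : absoluteGaloisGroup M,
      (hq.cutCharacter ⊥ 1).toArtinRep.toRepresentation.character δ =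
        (ContinuousRep.trivial (absoluteGaloisGroup M) ℂ ℂ).toRepresentation.character δ := by
    intro δ
    rw [character_toArtinRep_rankOne, FramedRep.det_apply, hcut1, map_one, Units.val_one]
    have : ((ContinuousRep.trivial (absoluteGaloisGroup M) ℂ ℂ).toRepresentation δ : ℂ →ₗ[ℂ] ℂ) = 1 := LinearMap.ext fun v ↦ rfl
    rw [Representation.character, this, LinearMap.trace_one, Module.finrank_self, Nat.cast_one]
  have hζ : artinLFunction (hq.cutCharacter ⊥ 1).toArtinRep s = NumberField.dedekindZeta M s := by
    rw [artinLFunction_eq_of_character_eq_holds _ _ hchar1]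
    exact artinLFunction_trivial_eq_dedekindZeta_holds (K := M) hs
  -- Λ-level: `Λ(σ) = Λ(𝟙_M) = Λ_{ζ_M}` through (11.7) (iii)
  have h𝔣' : GaloisRep.artinConductorNat σ =
      (differentIdeal (𝓞 K) (𝓞 M)).absNorm * GaloisRep.artinConductorNat (hq.cutCharacter ⊥ 1).toArtinRep := by
    have := ArtinRep.artinConductorNat_eq_of_isInducedFrom σ (hq.cutCharacter ⊥ 1).toArtinRep hind
    rwa [Module.finrank_fin_fun, pow_one] at this
  have h4Λ : completedArtinLFunction σ s = completedArtinLFunction (hq.cutCharacter ⊥ 1).toArtinRep s :=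
    completedArtinLFunction_eq_of_isInducedFrom_rankOne_of_artinConductorNat_eq σ (hq.cutCharacter ⊥ 1) hind h𝔣' hs
  have hζΛ : completedArtinLFunction (hq.cutCharacter ⊥ 1).toArtinRep s = completedDedekindZeta M s :=
    completedArtinLFunction_eq_completedDedekindZeta_of_forall_eq_one _ hcut1 hs
  -- the two class functions agree: `∑_{j<n} det ψ(γ)^j = n · [det ψ(γ) = 1]`
  have hfeq : (fun γ ↦ indClassFun (⊥ : Subgroup d.range) (fun h ↦ (((1 : (⊥ : Subgroup d.range) →* ℂˣ) h : ℂˣ) : ℂ)) (q γ)) =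
      ∑ j ∈ Finset.range n, fun γ ↦ ((FramedRep.det ψ γ : ℂˣ) : ℂ) ^ j := by
    funext γ
    simp only [MonoidHom.one_apply, Units.val_one, Finset.sum_apply]
    rw [indClassFun_bot_const_one]
    by_cases h1 : FramedRep.det ψ γ = 1
    · have hq1 : q γ = 1 := Subtype.ext (by rw [hqval, h1]; rfl)
      rw [if_pos hq1, h1, Units.val_one]
      simp [hn]
    · have hq1 : q γ ≠ 1 := fun h ↦ h1 (by rw [← hqval, h]; rfl)
      rw [if_neg hq1]
      have hx1 : ((FramedRep.det ψ γ : ℂˣ) : ℂ) ≠ 1 := fun h ↦ h1 (Units.ext h)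
      have hxn : ((FramedRep.det ψ γ : ℂˣ) : ℂ) ^ n = 1 := by
        have := congrArg (fun x : ℂˣ ↦ (x : ℂ)) (hpow γ)
        simpa only [Units.val_pow_eq_pow_val, Units.val_one] using this
      rw [geom_sum_eq hx1, hxn, sub_self, zero_div]
  constructor
  · -- completed realisations
    have hLHS : HasCompletedArtinRealization (K := K)
        (fun γ ↦ indClassFun (⊥ : Subgroup d.range) (fun h ↦ (((1 : (⊥ : Subgroup d.range) →* ℂˣ) h : ℂˣ) : ℂ)) (q γ))
        (completedArtinLFunction σ) :=
      ⟨d.range ⧸ (⊥ : Subgroup d.range) → ℂ, _, _, inferInstance, _, inferInstance, σ,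
        fun γ ↦ ArtinRep.character_monomial hq ⊥ 1 γ, fun _ _ ↦ rfl⟩
    have hRj : ∀ j : ℕ, HasCompletedArtinRealization (K := K) (fun γ ↦ ((FramedRep.det ψ γ : ℂˣ) : ℂ) ^ j)
        (completedArtinLFunction (Ψ j).toArtinRep) := fun j ↦ by
      have h := HasCompletedArtinRealization.of_artinRep (K := K) (Ψ j).toArtinRep
      have hf : (fun γ ↦ (Ψ j).toArtinRep.toRepresentation.character γ) = fun γ ↦ ((FramedRep.det ψ γ : ℂˣ) : ℂ) ^ j :=
        funext fun γ ↦ hcharΨ j γ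
      rwa [hf] at h
    have hRHS : HasCompletedArtinRealization (K := K)
        (∑ j ∈ Finset.range n, fun γ ↦ ((FramedRep.det ψ γ : ℂˣ) : ℂ) ^ j)
        (∏ j ∈ Finset.range n, completedArtinLFunction (Ψ j).toArtinRep) := by
      have := HasCompletedArtinRealization.sum (K := K) hasseArf_family (Finset.range n) (fun _ ↦ 1) (fun j _ ↦ hRj j)
      simpa only [one_nsmul, pow_one] using this
    rw [hfeq] at hLHS
    have hEq := HasCompletedArtinRealization.apply_eq hLHS hRHS hs
    rw [Finset.prod_apply] at hEq
    rw [← hζΛ, ← h4Λ, hEq]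
  · -- L-level realisations
    have hLHS : HasArtinRealization (K := K)
        (fun γ ↦ indClassFun (⊥ : Subgroup d.range) (fun h ↦ (((1 : (⊥ : Subgroup d.range) →* ℂˣ) h : ℂˣ) : ℂ)) (q γ))
        (artinLFunction σ) :=
      ⟨d.range ⧸ (⊥ : Subgroup d.range) → ℂ, _, _, inferInstance, _, inferInstance, σ,
        fun γ ↦ ArtinRep.character_monomial hq ⊥ 1 γ, fun _ _ ↦ rfl⟩
    have hRj : ∀ j : ℕ, HasArtinRealization (K := K) (fun γ ↦ ((FramedRep.det ψ γ : ℂˣ) : ℂ) ^ j)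
        (artinLFunction (Ψ j).toArtinRep) := fun j ↦ by
      have h := HasArtinRealization.of_artinRep (K := K) (Ψ j).toArtinRep
      have hf : (fun γ ↦ (Ψ j).toArtinRep.toRepresentation.character γ) = fun γ ↦ ((FramedRep.det ψ γ : ℂˣ) : ℂ) ^ j :=
        funext fun γ ↦ hcharΨ j γ
      rwa [hf] at h
    have hRHS : HasArtinRealization (K := K)
        (∑ j ∈ Finset.range n, fun γ ↦ ((FramedRep.det ψ γ : ℂˣ) : ℂ) ^ j)
        (∏ j ∈ Finset.range n, artinLFunction (Ψ j).toArtinRep) := by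
      have := HasArtinRealization.sum (K := K) (Finset.range n) (fun _ ↦ 1) (fun j _ ↦ hRj j)
      simpa only [one_nsmul, pow_one] using this
    rw [hfeq] at hLHS
    have hEq := HasArtinRealization.apply_eq hLHS hRHS hs
    rw [Finset.prod_apply] at hEq
    rw [← hζ, ← h4, hEq]

end Literature.NumberTheory.Automorphic
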